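import Summits.SmoothPoincare4.SmoothPoincare4.Theorems.SymplecticOrigamiGromovRecognitionRelEndHelperJHolomorphicOfCompactOpenLimit
import Summits.SmoothPoincare4.SmoothPoincare4.Theorems.SymplecticOrigamiGromovRecognitionRelEndHelperLinearisedCRFamily

/-!
# Chart data for the normal velocity of a family of `J`-curves at a point
(registered helper `helper_normalVelocityChartData` of line `cross-cap-laurent`, crux `GromovRecognitionRelEnd`,
item stmt-SmoothPoincare4-11009; manifold-to-flat localisation for the child stub
`stub_normalVelocityDichotomy` of the split piece `LocalFoliationEmbeddedSpheres`, item
stmt-SmoothPoincare4-16778)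

Setting (Wendl 2018, proof of Prop. 2.53): `X` a `4`-manifold with almost complex structure `JX`,
`W a : ℂ → X` (`‖a‖ < ε`) a family of `JX`-holomorphic curves, jointly smooth, `W 0 = w₀` smooth,
`JX`-holomorphic and immersed at `z₁`; `πN` smooth on an open `N`, vanishing along `w₀` near `z₁`,
with `dπN` onto at `w₀ z₁`.  The NORMAL VELOCITY in direction `c` is
`σ z = (fderiv ℝ (fun a => πN (W a z)) 0) c`.

Claim (`helper_normalVelocityChartData`): in the chart `φ = extChartAt x₀` at `x₀ = w₀ z₁` all of this
becomes FLAT data satisfying, verbatim, the hypotheses of the flat dichotomy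
`helper_linearisedNormalDichotomyFlat`: a global smooth almost complex structure `Jg` on `ℝ⁴` reading
`JX` near `x₀` (`UniformLimit.exists_globalACS`), the globalised chart expression `b` of
`z ↦ w₀ (z + z₁)` (`exists_chartCurve_global`; immersed at `0`, flat `Jg`-holomorphic on a disc), the
field `ξ z = ∂_c (φ ∘ W · (z + z₁))|₀` — a solution of the LINEARISED Cauchy–Riemann equation along
`b` by `helper_linearisedCRFamily`, as are the tangential fields `z ↦ db_z w` (the same lemma applied
to the reparametrisation family `b (z + a w)`) —, and the leaf function `ψ = πN ∘ φ⁻¹` (smooth on an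
open `T ∋ b 0`, `ψ ∘ b = 0`, `dψ_{b 0}` onto because `dπN_{x₀} = dψ_{φ x₀} ∘ dφ_{x₀}`); together with
the two dictionary entries used downstream: `σ (z + z₁) = dψ_{b z} (ξ z)` on the disc, and
`dψ_{b 0} (dφ V) = dπN V`, `dψ_{b 0} (Jg (dφ V)) = dπN (JX V)` (the frame expression of `JX` at the
base point is `dφ ∘ JX ∘ dφ⁻¹`).

References: C. Wendl, *Holomorphic Curves in Low Dimensions*, LNM 2216 (2018), Prop. 2.53.  No new
definitions, notation or instances.
-/

noncomputable section

open scoped Manifold ContDiff Topology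
open Set Function Filter Metric Literature.Geometry.Symplectic

-- the prescribed namespace `Summit.<P>.<Sub>.…` duplicates `SmoothPoincare4` (P = Sub)
set_option linter.dupNamespace false

namespace Summit.SmoothPoincare4.SmoothPoincare4.Theorems.GromovRecognitionRelEnd.CrossCapLaurent

namespace NormalVelocityChart

variable {X : Type} [TopologicalSpace X] [ChartedSpace (EuclideanSpace ℝ (Fin 4)) X]

/-- The slices `W a` of a jointly smooth family are smooth. [folklore] -/
theorem contMDiff_slice {W : ℂ → ℂ → X} {ε : ℝ}
    (hW : ContMDiffOn 𝓘(ℝ, ℂ × ℂ) (𝓡 4) ∞ (fun q : ℂ × ℂ => W q.1 q.2) (ball 0 ε ×ˢ univ))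
    {a : ℂ} (ha : ‖a‖ < ε) (z₁ : ℂ) : ContMDiff 𝓘(ℝ, ℂ) (𝓡 4) ∞ (fun z : ℂ => W a (z + z₁)) := by
  have h1 : ContMDiff 𝓘(ℝ, ℂ) 𝓘(ℝ, ℂ × ℂ) ∞ (fun z : ℂ => (a, z + z₁)) :=
    contMDiff_iff_contDiff.2 (contDiff_const.prodMk (contDiff_id.add contDiff_const))
  exact hW.comp_contMDiff h1 fun z => ⟨mem_ball_zero_iff.2 ha, mem_univ _⟩

/-- Smoothness of a parametric derivative with values in a normed space: if `g : ℂ × ℂ → G` is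
`C^∞` on an open `S ∋ (0, z₀)` then `z ↦ fderiv ℝ (fun a => g (a, z)) 0 c` is `C^∞` at `z₀`.
[folklore] -/
theorem contDiffAt_fderiv_apply {G : Type*} [NormedAddCommGroup G] [NormedSpace ℝ G]
    {g : ℂ × ℂ → G} {S : Set (ℂ × ℂ)} {z₀ : ℂ} (hS : IsOpen S)
    (h0 : ((0 : ℂ), z₀) ∈ S) (hg : ContDiffOn ℝ ∞ g S) (c : ℂ) :
    ContDiffAt ℝ ∞ (fun z : ℂ => fderiv ℝ (fun a : ℂ => g (a, z)) 0 c) z₀ := by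
  have hga : ContDiffAt ℝ ∞ g (0, z₀) := hg.contDiffAt (hS.mem_nhds h0)
  have hunc : ContDiffAt ℝ ∞ (Function.uncurry fun z a : ℂ => g (a, z)) (z₀, 0) :=
    hga.comp₂ (f₁ := Prod.snd) (f₂ := Prod.fst) (x := (z₀, (0 : ℂ))) contDiffAt_snd contDiffAt_fst
  have hmn : (∞ : WithTop ℕ∞) + 1 ≤ ∞ := le_rfl
  exact (hunc.fderiv (g := fun _ : ℂ => (0 : ℂ)) contDiffAt_const hmn).clm_apply contDiffAt_const

/-- The `a`-derivative of the reparametrisation family `a ↦ b (z + a w)` at `a = 0` is `db_z w`.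
[folklore] -/
theorem fderiv_repar {G : Type*} [NormedAddCommGroup G] [NormedSpace ℝ G] {b : ℂ → G}
    (hb : Differentiable ℝ b) (z w : ℂ) :
    fderiv ℝ (fun a : ℂ => b (z + a * w)) 0 1 = fderiv ℝ b z w := by
  have h1 : HasFDerivAt (fun a : ℂ => z + a * w) (w • ContinuousLinearMap.id ℝ ℂ) 0 :=
    ((hasFDerivAt_id (𝕜 := ℝ) (0 : ℂ)).mul_const w).const_add z
  have h2 : HasFDerivAt b (fderiv ℝ b z) (z + 0 * w) := by
    rw [zero_mul, add_zero]; exact (hb z).hasFDerivAt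
  have hcomp : (fun a : ℂ => b (z + a * w)) = b ∘ fun a : ℂ => z + a * w := rfl
  rw [hcomp, (h2.comp 0 h1).fderiv]
  simp

/-- The `z`-derivative of `z ↦ b (z + a w)` is `db_{z + a w}`. [folklore] -/
theorem fderiv_repar_z {G : Type*} [NormedAddCommGroup G] [NormedSpace ℝ G] {b : ℂ → G}
    (hb : Differentiable ℝ b) (a w z : ℂ) :
    fderiv ℝ (fun z : ℂ => b (z + a * w)) z = fderiv ℝ b (z + a * w) := by
  have h1 : HasFDerivAt (fun z : ℂ => z + a * w) (ContinuousLinearMap.id ℝ ℂ) z :=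
    (hasFDerivAt_id (𝕜 := ℝ) z).add_const (a * w)
  have hcomp : (fun z : ℂ => b (z + a * w)) = b ∘ fun z : ℂ => z + a * w := rfl
  rw [hcomp, ((hb _).hasFDerivAt.comp z h1).fderiv]
  ext v
  simp

end NormalVelocityChart

open NormalVelocityChart in
/-- **Registered helper `helper_normalVelocityChartData`** (see the module docstring): the flat
package at a point for the normal velocity of a family of `JX`-holomorphic curves, with the
dictionary back to the manifold. [cite: Wendl2018, Prop. 2.53] -/
theorem helper_normalVelocityChartData : ∀ (X : Type) [TopologicalSpace X] [T2Space X] [SecondCountableTopology X] [ChartedSpace (EuclideanSpace ℝ (Fin 4)) X] [IsManifold (𝓡 4) ∞ X] (JX : Literature.Geometry.Symplectic.AlmostComplexStructure (𝓡 4) ∞ X) (W : ℂ → ℂ → X) (w₀ : ℂ → X) (N : Set X) (πN : X → ℂ) (ε : ℝ) (z₁ c : ℂ), 0 < ε → IsOpen N → ContMDiffOn (𝓡 4) 𝓘(ℝ, ℂ) ∞ πN N → ContMDiff 𝓘(ℝ, ℂ) (𝓡 4) ∞ w₀ → Literature.Geometry.Symplectic.IsJHolomorphic (𝓡 4) (fun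 y => JX y) w₀ → Function.Injective (mfderiv 𝓘(ℝ, ℂ) (𝓡 4) w₀ z₁) → (∀ᶠ z in 𝓝 z₁, w₀ z ∈ N ∧ πN (w₀ z) = 0) → Function.Surjective (mfderiv (𝓡 4) 𝓘(ℝ, ℂ) πN (w₀ z₁)) → (∀ z : ℂ, W 0 z = w₀ z) → (∀ a : ℂ, ‖a‖ < ε → Literature.Geometry.Symplectic.IsJHolomorphic (𝓡 4) (fun y => JX y) (W a)) → ContMDiffOn 𝓘(ℝ, ℂ × ℂ) (𝓡 4) ∞ (fun q : ℂ × ℂ => W q.1 q.2) (Metric.ball 0 ε ×ˢ Set.univ) → ∃ (Jg : EuclideanSpace ℝ (Fin 4) → EuclideanSpace ℝ (Fin 4) →L[ℝ] EuclideanSpace ℝ (Fin 4)) (b ξ : ℂ → EuclideanSpace ℝ (Fin 4)) (ψ : EuclideanSpace ℝ (Fin 4) → ℂ) (T : Set (EuclideanSpace ℝ (Fin 4))) (R : ℝ), ContDiff ℝ ∞ Jg ∧ ContDiff ℝ ∞ b ∧ 0 < R ∧ Function.Injective (fderiv ℝ b 0) ∧ (∀ z ∈ Metric.ball (0 : ℂ)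 R, ∀ α : ℂ, fderiv ℝ b z (Complex.I * α) = Jg (b z) (fderiv ℝ b z α)) ∧ (∀ z ∈ Metric.ball (0 : ℂ) R, ∀ w : EuclideanSpace ℝ (Fin 4), Jg (b z) (Jg (b z) w) = -w) ∧ (∀ z ∈ Metric.ball (0 : ℂ) R, ∀ w ζ : ℂ, fderiv ℝ (fun z : ℂ => fderiv ℝ b z w) z (Complex.I * ζ) = Jg (b z) (fderiv ℝ (fun z : ℂ => fderiv ℝ b z w) z ζ) + (fderiv ℝ Jg (b z) (fderiv ℝ b z w)) (fderiv ℝ b z ζ)) ∧ ContDiffOn ℝ ∞ ξ (Metric.ball 0 R) ∧ (∀ z ∈ Metric.ball (0 : ℂ) R, ∀ ζ : ℂ, fderiv ℝ ξ z (Complex.I * ζ) = Jg (b z) (fderiv ℝ ξ z ζ) + (fderiv ℝ Jg (b z) (ξ z)) (fderiv ℝ b z ζ)) ∧ IsOpen T ∧ b 0 ∈ T ∧ ContDiffOn ℝ ∞ ψ T ∧ (∀ z ∈ Metric.ball (0 : ℂ) R, ψ (b z) = 0) ∧ Function.Surjective (fderiv ℝ ψ (b 0)) ∧ (∀ z ∈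 Metric.ball (0 : ℂ) R, fderiv ℝ (fun a : ℂ => πN (W a (z + z₁))) 0 c = fderiv ℝ ψ (b z) (ξ z)) ∧ (∀ V : TangentSpace (𝓡 4) (w₀ z₁), fderiv ℝ ψ (b 0) (mfderiv (𝓡 4) 𝓘(ℝ, EuclideanSpace ℝ (Fin 4)) (extChartAt (𝓡 4) (w₀ z₁)) (w₀ z₁) V) = mfderiv (𝓡 4) 𝓘(ℝ, ℂ) πN (w₀ z₁) V ∧ fderiv ℝ ψ (b 0) (Jg (b 0) (mfderiv (𝓡 4) 𝓘(ℝ, EuclideanSpace ℝ (Fin 4)) (extChartAt (𝓡 4) (w₀ z₁)) (w₀ z₁) V)) = mfderiv (𝓡 4) 𝓘(ℝ, ℂ) πN (w₀ z₁) (JX (w₀ z₁) V)) := by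
  intro X _ _ _ _ _ JX W w₀ N πN ε z₁ c hε hN hπ hw₀ hJw₀ hinj hzero hsurj hW0 hJW hW
  -- ### the chart at `x₀ = w₀ z₁` and the global coordinate structure
  set x₀ : X := w₀ z₁ with hx₀
  obtain ⟨Jg, δ, hδ, hJg, hJg2, hJgE⟩ := UniformLimit.exists_globalACS JX x₀
  -- ### the translated curve and its globalised chart expression `b`
  set w₀' : ℂ → X := w₀ ∘ fun z : ℂ => z + z₁ with hw₀'
  have hw₀'s : ContMDiff 𝓘(ℝ, ℂ) (𝓡 4) ∞ w₀' := contMDiff_comp_add_right hw₀ z₁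
  have hw₀'J : IsJHolomorphic (𝓡 4) (fun y => JX y) w₀' := hJw₀.comp_add_right hw₀ z₁
  have hw₀'0 : w₀' 0 = x₀ := by simp [hw₀', hx₀]
  obtain ⟨b, Rb, hRb, hb, hbR, hbJ, hb0⟩ := exists_chartCurve_global
    (fun x => (JX x : TangentSpace (𝓡 4) x →L[ℝ] TangentSpace (𝓡 4) x)) hJgE hw₀'s hw₀'J hw₀'0 hδ
  have hbinj : Injective (fderiv ℝ b 0) := hb0 (injective_mfderiv_comp_add_right hw₀ hinj)
  -- ### the family in the chart
  set Φ : ℂ × ℂ → EuclideanSpace ℝ (Fin 4) := fun q => extChartAt (𝓡 4) x₀ (W q.1 (q.2 + z₁))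
    with hΦ_def
  set G : ℂ × ℂ → X := fun q => W q.1 (q.2 + z₁) with hG_def
  have hGs : ContMDiffOn 𝓘(ℝ, ℂ × ℂ) (𝓡 4) ∞ G (ball 0 ε ×ˢ univ) := by
    have h1 : ContMDiff 𝓘(ℝ, ℂ × ℂ) 𝓘(ℝ, ℂ × ℂ) ∞ (fun q : ℂ × ℂ => (q.1, q.2 + z₁)) :=
      contMDiff_iff_contDiff.2 (contDiff_fst.prodMk (contDiff_snd.add contDiff_const))
    exact hW.comp h1.contMDiffOn fun q hq => ⟨hq.1, mem_univ _⟩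
  set O : Set X := (chartAt (EuclideanSpace ℝ (Fin 4)) x₀).source ∩
    extChartAt (𝓡 4) x₀ ⁻¹' ball (extChartAt (𝓡 4) x₀ x₀) δ with hO_def
  have hOo : IsOpen O := by
    rw [hO_def, ← extChartAt_source (𝓡 4)]
    exact isOpen_extChartAt_preimage' x₀ isOpen_ball
  set S₀ : Set (ℂ × ℂ) := (ball 0 ε ×ˢ univ) ∩ G ⁻¹' O with hS₀_def
  have hS₀o : IsOpen S₀ := hGs.continuousOn.isOpen_inter_preimage (isOpen_ball.prod isOpen_univ) hOo
  have hGO : ∀ q ∈ S₀, G q ∈ O := fun q hq => hq.2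
  have h0S : ∀ z ∈ ball (0 : ℂ) Rb, ((0 : ℂ), z) ∈ S₀ := by
    intro z hz
    obtain ⟨hsrc, hbz, hball⟩ := hbR z hz
    have hG0 : G (0, z) = w₀' z := by simp [hG_def, hw₀', hW0]
    refine ⟨⟨mem_ball_self hε, mem_univ _⟩, ?_⟩
    show G (0, z) ∈ O
    rw [hG0]
    exact ⟨hsrc, by rw [mem_preimage, ← hbz]; exact hball⟩
  have hΦs : ContDiffOn ℝ ∞ Φ S₀ := by
    have h := (contMDiffOn_extChartAt (I := 𝓡 4) (n := ∞) (x := x₀)).comp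
      (hGs.mono fun q hq => hq.1) fun q hq => (hGO q hq).1
    exact (contMDiffOn_iff_contDiffOn.1 h)
  have hΦ0 : ∀ z ∈ ball (0 : ℂ) Rb, Φ (0, z) = b z := by
    intro z hz
    obtain ⟨-, hbz, -⟩ := hbR z hz
    rw [hbz]
    simp [hΦ_def, hw₀', hW0]
  -- slices are smooth, `JX`-holomorphic, and flat `Jg`-holomorphic on `S₀`
  have hWa : ∀ a : ℂ, ‖a‖ < ε → ContMDiff 𝓘(ℝ, ℂ) (𝓡 4) ∞ (W a) := by
    intro a ha
    have h := contMDiff_slice hW ha 0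
    simp only [add_zero] at h
    exact h
  have hslice : ∀ p ∈ S₀, ∀ ζ : ℂ, fderiv ℝ (fun z : ℂ => Φ (p.1, z)) p.2 (Complex.I * ζ) =
      Jg (Φ p) (fderiv ℝ (fun z : ℂ => Φ (p.1, z)) p.2 ζ) := by
    intro p hp ζ
    have ha : ‖p.1‖ < ε := mem_ball_zero_iff.1 hp.1.1
    have hγ : ContMDiff 𝓘(ℝ, ℂ) (𝓡 4) ∞ (fun z : ℂ => W p.1 (z + z₁)) := contMDiff_slice hW ha z₁
    have hγJ : IsJHolomorphic (𝓡 4) (fun y => JX y) (fun z : ℂ => W p.1 (z + z₁)) :=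
      (hJW p.1 ha).comp_add_right (hWa p.1 ha) z₁
    obtain ⟨hsrc, hball⟩ := hGO p hp
    have h1 := jHolomorphic_fderiv_chart
      (fun x => (JX x : TangentSpace (𝓡 4) x →L[ℝ] TangentSpace (𝓡 4) x)) (x₀ := x₀)
      ((hγ p.2)) (hγJ p.2) hsrc ζ
    have h2 := hJgE (W p.1 (p.2 + z₁)) hsrc hball
    show fderiv ℝ (fun z : ℂ => extChartAt (𝓡 4) x₀ (W p.1 (z + z₁))) p.2 (Complex.I * ζ) =
      Jg (extChartAt (𝓡 4) x₀ (W p.1 (p.2 + z₁)))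
        (fderiv ℝ (fun z : ℂ => extChartAt (𝓡 4) x₀ (W p.1 (z + z₁))) p.2 ζ)
    rw [h1, h2]
  -- ### the field `ξ` and the linearised equation
  set ξ : ℂ → EuclideanSpace ℝ (Fin 4) := fun z => fderiv ℝ (fun a : ℂ => Φ (a, z)) 0 c with hξ_def
  have hξs : ∀ z ∈ ball (0 : ℂ) Rb, ContDiffAt ℝ ∞ ξ z := fun z hz =>
    contDiffAt_fderiv_apply hS₀o (h0S z hz) hΦs c
  have hΦ0ev : ∀ z ∈ ball (0 : ℂ) Rb, (fun z : ℂ => Φ (0, z)) =ᶠ[𝓝 z] b := fun z hz => by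
    filter_upwards [isOpen_ball.mem_nhds hz] with y hy using hΦ0 y hy
  have hlin : ∀ z ∈ ball (0 : ℂ) Rb, ∀ ζ : ℂ, fderiv ℝ ξ z (Complex.I * ζ) =
      Jg (b z) (fderiv ℝ ξ z ζ) + (fderiv ℝ Jg (b z) (ξ z)) (fderiv ℝ b z ζ) := by
    intro z hz ζ
    have h := helper_linearisedCRFamily (EuclideanSpace ℝ (Fin 4)) Jg univ Φ S₀ isOpen_univ hS₀o
      hJg.contDiffOn hΦs (mapsTo_univ _ _) hslice (0, z) (h0S z hz) c ζ
    simp only at h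
    rw [hΦ0 z hz, (hΦ0ev z hz).fderiv_eq] at h
    exact h
  -- ### the tangential fields
  have hbd : Differentiable ℝ b := hb.differentiable (by simp)
  have htan : ∀ z ∈ ball (0 : ℂ) Rb, ∀ w ζ : ℂ,
      fderiv ℝ (fun z : ℂ => fderiv ℝ b z w) z (Complex.I * ζ) =
        Jg (b z) (fderiv ℝ (fun z : ℂ => fderiv ℝ b z w) z ζ) +
          (fderiv ℝ Jg (b z) (fderiv ℝ b z w)) (fderiv ℝ b z ζ) := by
    intro z hz w ζ
    -- the reparametrisation family `Ψ (a, z) = b (z + a w)` on `Sw = {z + a w ∈ ball 0 Rb}`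
    set Ψ : ℂ × ℂ → EuclideanSpace ℝ (Fin 4) := fun q => b (q.2 + q.1 * w) with hΨ_def
    set Sw : Set (ℂ × ℂ) := (fun q : ℂ × ℂ => q.2 + q.1 * w) ⁻¹' ball 0 Rb with hSw_def
    have hlinmap : Continuous (fun q : ℂ × ℂ => q.2 + q.1 * w) := by fun_prop
    have hSwo : IsOpen Sw := isOpen_ball.preimage hlinmap
    have hΨs : ContDiffOn ℝ ∞ Ψ Sw :=
      (hb.comp (contDiff_snd.add (contDiff_fst.mul contDiff_const))).contDiffOn
    have hΨslice : ∀ p ∈ Sw, ∀ ζ : ℂ, fderiv ℝ (fun z : ℂ => Ψ (p.1, z)) p.2 (Complex.I * ζ) =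
        Jg (Ψ p) (fderiv ℝ (fun z : ℂ => Ψ (p.1, z)) p.2 ζ) := by
      intro p hp ζ'
      show fderiv ℝ (fun z : ℂ => b (z + p.1 * w)) p.2 (Complex.I * ζ') =
        Jg (b (p.2 + p.1 * w)) (fderiv ℝ (fun z : ℂ => b (z + p.1 * w)) p.2 ζ')
      rw [fderiv_repar_z hbd]
      exact hbJ _ hp _
    have h0 : ((0 : ℂ), z) ∈ Sw := by
      show z + 0 * w ∈ ball (0 : ℂ) Rb
      simpa using hz
    have h := helper_linearisedCRFamily (EuclideanSpace ℝ (Fin 4)) Jg univ Ψ Sw isOpen_univ hSwo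
      hJg.contDiffOn hΨs (mapsTo_univ _ _) hΨslice (0, z) h0 1 ζ
    have hrep : (fun z : ℂ => fderiv ℝ (fun a : ℂ => Ψ (a, z)) 0 1) = fun z => fderiv ℝ b z w := by
      funext y
      exact fderiv_repar hbd y w
    have hΨ0 : (fun z : ℂ => Ψ (((0 : ℂ), z).1, z)) = b := by
      funext y
      show b (y + 0 * w) = b y
      rw [zero_mul, add_zero]
    have hΨ00 : Ψ (0, z) = b z := by show b (z + 0 * w) = b z; rw [zero_mul, add_zero]
    simp only at h
    rw [hrep, hΨ00, fderiv_repar hbd z w] at h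
    have hΨ0' : (fun z : ℂ => Ψ (0, z)) = b := by
      funext y
      show b (y + 0 * w) = b y
      rw [zero_mul, add_zero]
    rw [hΨ0'] at h
    exact h
  -- ### the leaf function `ψ = πN ∘ φ⁻¹`
  set ψ : EuclideanSpace ℝ (Fin 4) → ℂ := fun y => πN ((extChartAt (𝓡 4) x₀).symm y) with hψ_def
  set T : Set (EuclideanSpace ℝ (Fin 4)) := (extChartAt (𝓡 4) x₀).target ∩
    (extChartAt (𝓡 4) x₀).symm ⁻¹' N with hT_def
  have hTo : IsOpen T :=
    (continuousOn_extChartAt_symm x₀).isOpen_inter_preimage (isOpen_extChartAt_target x₀) hN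
  have hx₀N : x₀ ∈ N := (hzero.self_of_nhds).1
  have hb0eq : b 0 = extChartAt (𝓡 4) x₀ x₀ := by
    obtain ⟨-, hbz, -⟩ := hbR 0 (mem_ball_self hRb)
    rw [hbz, hw₀'0]
  have hb0T : b 0 ∈ T := by
    rw [hb0eq]
    exact ⟨mem_extChartAt_target x₀, by
      rw [mem_preimage, extChartAt_to_inv x₀]; exact hx₀N⟩
  have hψs : ContDiffOn ℝ ∞ ψ T := by
    have h := hπ.comp ((contMDiffOn_extChartAt_symm (I := 𝓡 4) (n := ∞) x₀).mono inter_subset_left)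
      fun y hy => hy.2
    exact contMDiffOn_iff_contDiffOn.1 h
  -- `ψ ∘ φ = πN` on the chart domain
  have hψφ : ∀ x ∈ (chartAt (EuclideanSpace ℝ (Fin 4)) x₀).source,
      ψ (extChartAt (𝓡 4) x₀ x) = πN x := fun x hx => by
    simp only [hψ_def]
    rw [(extChartAt (𝓡 4) x₀).left_inv (by rwa [extChartAt_source])]
  -- ### a common radius
  have hzero' : ∀ᶠ z in 𝓝 (0 : ℂ), πN (w₀' z) = 0 := by
    have hc : ContinuousAt (fun z : ℂ => z + z₁) 0 := by fun_prop
    have h := hc.eventually (show ∀ᶠ y in 𝓝 ((fun z : ℂ => z + z₁) 0), w₀ y ∈ N ∧ πN (w₀ y) = 0 by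
      simpa using hzero)
    filter_upwards [h] with z hz using hz.2
  have hbT : ∀ᶠ z in 𝓝 (0 : ℂ), b z ∈ T := hb.continuous.continuousAt.preimage_mem_nhds (hTo.mem_nhds hb0T)
  obtain ⟨R, hR, hRb', hRzero, hRT⟩ : ∃ R : ℝ, 0 < R ∧ R ≤ Rb ∧
      (∀ z ∈ ball (0 : ℂ) R, πN (w₀' z) = 0) ∧ (∀ z ∈ ball (0 : ℂ) R, b z ∈ T) := by
    obtain ⟨r, hr, hrb⟩ := Metric.eventually_nhds_iff_ball.1 (hzero'.and hbT)
    exact ⟨min r Rb, lt_min hr hRb, min_le_right _ _, fun z hz => (hrb z (ball_subset_ball (min_le_left _ _) hz)).1,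
      fun z hz => (hrb z (ball_subset_ball (min_le_left _ _) hz)).2⟩
  have hballR : ball (0 : ℂ) R ⊆ ball 0 Rb := ball_subset_ball hRb'
  -- ### the derivative dictionary at the base point
  have hx₀src : x₀ ∈ (chartAt (EuclideanSpace ℝ (Fin 4)) x₀).source := mem_chart_source _ x₀
  have hψd0 : DifferentiableAt ℝ ψ (extChartAt (𝓡 4) x₀ x₀) := by
    have := (hψs.contDiffAt (hTo.mem_nhds (hb0eq ▸ hb0T))).differentiableAt (by simp)
    exact this
  have hchain : mfderiv (𝓡 4) 𝓘(ℝ, ℂ) πN x₀ =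
      (fderiv ℝ ψ (extChartAt (𝓡 4) x₀ x₀)).comp (mfderiv (𝓡 4) 𝓘(ℝ, EuclideanSpace ℝ (Fin 4)) (extChartAt (𝓡 4) x₀) x₀) := by
    have hφ' : HasMFDerivAt (𝓡 4) 𝓘(ℝ, EuclideanSpace ℝ (Fin 4)) (extChartAt (𝓡 4) x₀) x₀ (mfderiv (𝓡 4) 𝓘(ℝ, EuclideanSpace ℝ (Fin 4)) (extChartAt (𝓡 4) x₀) x₀) :=
      (mdifferentiableAt_extChartAt (I := 𝓡 4) hx₀src).hasMFDerivAt
    have hψ' : HasMFDerivAt 𝓘(ℝ, EuclideanSpace ℝ (Fin 4)) 𝓘(ℝ, ℂ) ψ (extChartAt (𝓡 4) x₀ x₀)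
        (fderiv ℝ ψ (extChartAt (𝓡 4) x₀ x₀)) := hψd0.hasFDerivAt.hasMFDerivAt
    have hcomp := hψ'.comp x₀ hφ'
    have hev : (ψ ∘ extChartAt (𝓡 4) x₀) =ᶠ[𝓝 x₀] πN := by
      filter_upwards [(chartAt (EuclideanSpace ℝ (Fin 4)) x₀).open_source.mem_nhds hx₀src] with x hx
      exact hψφ x hx
    exact (hcomp.congr_of_eventuallyEq hev.symm).mfderiv
  have hAJ : ∀ V : TangentSpace (𝓡 4) x₀, Jg (extChartAt (𝓡 4) x₀ x₀) (mfderiv (𝓡 4) 𝓘(ℝ, EuclideanSpace ℝ (Fin 4)) (extChartAt (𝓡 4) x₀) x₀ V) = mfderiv (𝓡 4) 𝓘(ℝ, EuclideanSpace ℝ (Fin 4)) (extChartAt (𝓡 4) x₀) x₀ (JX x₀ V) := by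
    intro V
    rw [hJgE x₀ hx₀src (mem_ball_self hδ), inTangentCoordinates_id_apply _ hx₀src,
      mfderivWithin_extChartAt_symm_apply_mfderiv_extChartAt hx₀src]
  -- ### the translation identity `σ (z + z₁) = dψ_{b z} (ξ z)`
  have htrans : ∀ z ∈ ball (0 : ℂ) R, fderiv ℝ (fun a : ℂ => πN (W a (z + z₁))) 0 c =
      fderiv ℝ ψ (b z) (ξ z) := by
    intro z hz
    have hzb : z ∈ ball (0 : ℂ) Rb := hballR hz
    -- `a ↦ πN (W a (z + z₁))` agrees with `ψ ∘ Φ (·, z)` near `a = 0`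
    have hSz : ∀ᶠ a in 𝓝 (0 : ℂ), (a, z) ∈ S₀ := by
      have hc : ContinuousAt (fun a : ℂ => (a, z)) 0 := by fun_prop
      exact hc.preimage_mem_nhds (hS₀o.mem_nhds (h0S z hzb))
    have hev : (fun a : ℂ => πN (W a (z + z₁))) =ᶠ[𝓝 0] fun a => ψ (Φ (a, z)) := by
      filter_upwards [hSz] with a ha
      exact (hψφ _ (hGO _ ha).1).symm
    rw [hev.fderiv_eq]
    have hΦa : DifferentiableAt ℝ (fun a : ℂ => Φ (a, z)) 0 := by
      have h1 : ContDiffAt ℝ ∞ Φ (0, z) := hΦs.contDiffAt (hS₀o.mem_nhds (h0S z hzb))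
      have h2 : ContDiffAt ℝ ∞ (fun a : ℂ => ((a, z) : ℂ × ℂ)) 0 := by fun_prop
      exact (h1.comp 0 h2).differentiableAt (by simp)
    have hψd : DifferentiableAt ℝ ψ (Φ (0, z)) := by
      rw [hΦ0 z hzb]
      exact (hψs.contDiffAt (hTo.mem_nhds (hRT z hz))).differentiableAt (by simp)
    show fderiv ℝ (ψ ∘ fun a : ℂ => Φ (a, z)) 0 c = _
    rw [fderiv_comp 0 hψd hΦa]
    simp only [ContinuousLinearMap.coe_comp, comp_apply]
    rw [hΦ0 z hzb]
  -- ### assemble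
  refine ⟨Jg, b, ξ, ψ, T, R, hJg, hb, hR, hbinj, fun z hz => hbJ z (hballR hz), fun z _ w => hJg2 _ w,
    fun z hz => htan z (hballR hz), fun z hz => (hξs z (hballR hz)).contDiffWithinAt,
    fun z hz => hlin z (hballR hz), hTo, hb0T, hψs, fun z hz => ?_, ?_, htrans, fun V => ⟨?_, ?_⟩⟩
  · -- `ψ (b z) = πN (w₀' z) = 0`
    obtain ⟨hsrc, hbz, -⟩ := hbR z (hballR hz)
    rw [hbz, hψφ _ hsrc]
    exact hRzero z hz
  · -- `dψ_{b 0}` is onto: `dπN = dψ ∘ dφ`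
    rw [hb0eq]
    intro y
    obtain ⟨V, hV⟩ := hsurj y
    refine ⟨mfderiv (𝓡 4) 𝓘(ℝ, EuclideanSpace ℝ (Fin 4)) (extChartAt (𝓡 4) x₀) x₀ V, ?_⟩
    rw [← hV, hchain]
    rfl
  · rw [hb0eq, hchain]; rfl
  · rw [hb0eq, hAJ, hchain]; rfl

end Summit.SmoothPoincare4.SmoothPoincare4.Theorems.GromovRecognitionRelEnd.CrossCapLaurent

end
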